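import Mathlib
import Literature.AlgebraicGeometry.Resolution.OriginLocalRing
import Literature.AlgebraicGeometry.Resolution.SmoothOfRegularFibre
import Literature.AlgebraicGeometry.Resolution.SmoothImpliesRegular
import Literature.RingTheory.RegularLocalRing.QuotientDVR
import Literature.AlgebraicGeometry.Resolution.RegularLocalRingsProofs
import Summits.ResolutionOfSingularities.ResolutionOfSingularities.Theorems.WeightedInvariantHypersurfaceLocalGameEFT3

/-!
# Door line `local-engine` (crux `HypersurfaceCentreConstruction`, stmt-ResolutionOfSingularities-19897):
# ι-RIGIDITY AT REGULAR PARAMETERS under clause (c11) `IotaJEssSmoothCompatible`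

Theorems only (no definitions, no claims about Hironaka's problem).  A structural consequence of the clauses of the
H2a‴/H2a⁗ candidates (`Theorems/WeightedInvariantHypersurfaceLocalGameEFT3.lean`, p501595) AS TYPED:

* `formallySmooth_origin`: for `k₀` perfect, `T` an essentially-of-finite-type REGULAR local `k₀`-algebra and
  `F ∈ 𝔪_T ∖ 𝔪_T²` a regular parameter, the evaluation map `k₀[X]_{(X)} → T`, `X ↦ F` (`k₀[X]_{(X)}` =
  `OriginLocalization k₀ 1` of the tree) is LOCAL, essentially of finite type, FLAT (torsion-free over a discrete
  valuation ring, `flat_origin`) with REGULAR closed fibre `T/(F)` (`isRegularLocalRing_fiber_origin`) over the perfect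
  residue field `k₀` (`perfectField_residueField_origin`), hence FORMALLY SMOOTH by the tree's regular-fibre form of
  Stacks 00TF (`formallySmooth_of_flat_of_isRegularLocalRing_fiber`, `SmoothOfRegularFibre.lean`);
* `iota_regularParameter_eq_origin` / `iota_regularParameter_eq`: consequently, under (c11)
  `IotaJEssSmoothCompatible ι J`, **`ι` takes ONE value at every regular parameter of every e.f.t. regular local
  `k₀`-algebra** (any dimension, any point) — `ι T F = ι (k₀[X]_{(X)}) X`;
* `iota_localization_lt_of_not_mem_sq`: independently of (c11), the canonical game clause (c9′) ((strat) + (adm))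
  with (c7) forces `ι (S_𝔭) f < ι S f` at every generization `𝔭 ∋ f` of a singular position `(S, f)` at which `f` is
  a regular parameter;
* `iota_regularParameter_lt_of_singular`: together, `ι` at ANY regular parameter is strictly below `ι S f` for every
  singular position whose hypersurface germ has such a generization (e.g. the generic point of an integral
  hypersurface).

Bearing (res-L1-w43-plan-1 RULINGS gen 8 #1 (iii), 2026-08-27: «door kernels of record; stub-9's word decides whether
[S6] consumes them»): these are the facts needed wherever `ι` must be compared at REGULAR points (the game clause's
drop conclusion fires only at singular successor germs); they also underlie the derivability of the seam
EFT4S ⇒ EFT3 ((o22)(ii), res-type-070's D3 route).  OURS, summit-side; AI book-keeping, weaker than expert review.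
[L1 W4.3 · typer of record res-type-061 · door registrar res-L1-w43-plan-1]

## References

* The Stacks Project, Tag 00TF (flat + smooth fibre ⇒ smooth), via the tree file `SmoothOfRegularFibre.lean`.
  [StacksProject]
* H. Matsumura, *Commutative Ring Theory*, CUP 1986, Thm. 11.2 (regular local of dimension one = DVR), Thm. 14.2
  (quotient by part of a regular system of parameters), via `QuotientDVR.lean` / `SmoothImpliesRegular.lean`.
  [Matsumura1987]
-/

set_option linter.dupNamespace false

noncomputable section

open IsLocalRing Literature.AlgebraicGeometry.Resolution MvPolynomial
open scoped TensorProduct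

namespace Summit.ResolutionOfSingularities.ResolutionOfSingularities.Cruxes.HypersurfaceCentreConstruction.LocalEngine

/-! ## The reference position `P₁ = k₀[X]_{(X)}` (`OriginLocalization k₀ 1`) and its maps `X ↦ F` -/

section Origin

variable {k₀ : Type} [Field k₀]

/-- `k₀[X]_{(X)}` is a discrete valuation ring. [folklore] -/
theorem isDiscreteValuationRing_origin :
    haveI := isDomain_of_isRegularLocalRing (OriginLocalization k₀ 1)
    IsDiscreteValuationRing (OriginLocalization k₀ 1) := by
  have hdim : ringKrullDim (OriginLocalization k₀ 1) = 1 := by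
    rw [ringKrullDim_originLocalization]; rfl
  exact Literature.RingTheory.RegularLocalRing.isDiscreteValuationRing_of_ringKrullDim_eq_one hdim

/-- The residue of `g ∈ k₀[X]` in the residue field of `k₀[X]_{(X)}` is its constant coefficient. [folklore] -/
theorem residue_algebraMap_origin (g : MvPolynomial (Fin 1) k₀) :
    residue (OriginLocalization k₀ 1) (algebraMap (MvPolynomial (Fin 1) k₀) (OriginLocalization k₀ 1) g) =
      algebraMap k₀ (ResidueField (OriginLocalization k₀ 1)) (constantCoeff g) := by
  rw [IsScalarTower.algebraMap_apply k₀ (OriginLocalization k₀ 1) (ResidueField (OriginLocalization k₀ 1)),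
    ResidueField.algebraMap_eq, IsScalarTower.algebraMap_apply k₀ (MvPolynomial (Fin 1) k₀) (OriginLocalization k₀ 1),
    MvPolynomial.algebraMap_eq]
  change Ideal.Quotient.mk _ _ = Ideal.Quotient.mk _ _
  rw [Ideal.Quotient.eq, ← map_sub, ← Localization.AtPrime.map_eq_maximalIdeal]
  refine Ideal.mem_map_of_mem _ ((mem_originIdeal_iff k₀ 1).mpr ?_)
  rw [map_sub, constantCoeff_C, sub_self]

/-- The residue field of `k₀[X]_{(X)}` is `k₀`: the structure map `k₀ → κ` is surjective. [folklore] -/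
theorem algebraMap_residueField_origin_surjective :
    Function.Surjective (algebraMap k₀ (ResidueField (OriginLocalization k₀ 1))) := by
  intro z
  obtain ⟨a, rfl⟩ := IsLocalRing.residue_surjective z
  obtain ⟨⟨f, s⟩, rfl⟩ := IsLocalization.mk'_surjective (originIdeal k₀ 1).primeCompl a
  have hs : constantCoeff (s : MvPolynomial (Fin 1) k₀) ≠ 0 := fun h => s.2 ((mem_originIdeal_iff k₀ 1).mpr h)
  refine ⟨constantCoeff f * (constantCoeff (s : MvPolynomial (Fin 1) k₀))⁻¹, ?_⟩
  have hspec := congrArg (residue (OriginLocalization k₀ 1))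
    (IsLocalization.mk'_spec (OriginLocalization k₀ 1) f s)
  rw [map_mul, residue_algebraMap_origin, residue_algebraMap_origin] at hspec
  have hs' : algebraMap k₀ (ResidueField (OriginLocalization k₀ 1)) (constantCoeff (s : MvPolynomial (Fin 1) k₀)) ≠ 0 :=
    (map_ne_zero _).mpr hs
  show algebraMap k₀ (ResidueField (OriginLocalization k₀ 1))
      (constantCoeff f * (constantCoeff (s : MvPolynomial (Fin 1) k₀))⁻¹) =
    residue (OriginLocalization k₀ 1) (IsLocalization.mk' (OriginLocalization k₀ 1) f s)
  rw [map_mul, map_inv₀, eq_comm, eq_mul_inv_iff_mul_eq₀ hs']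
  exact hspec

/-- … so the residue field of `k₀[X]_{(X)}` is perfect when `k₀` is. [folklore] -/
theorem perfectField_residueField_origin [PerfectField k₀] :
    PerfectField (ResidueField (OriginLocalization k₀ 1)) := by
  haveI : Algebra.IsAlgebraic k₀ (ResidueField (OriginLocalization k₀ 1)) :=
    ⟨fun z => by
      obtain ⟨c, rfl⟩ := algebraMap_residueField_origin_surjective (k₀ := k₀) z
      exact isAlgebraic_algebraMap c⟩
  exact Algebra.IsAlgebraic.perfectField k₀

end Origin

section Injective

variable {k₀ : Type} [Field k₀] {T : Type} [CommRing T] [Algebra (OriginLocalization k₀ 1) T]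

/-- Along a map `k₀[X]_{(X)} → T` into a domain with `X ↦ F ≠ 0` the map is injective (its kernel is a prime of the
discrete valuation ring `k₀[X]_{(X)}` not containing `X`). [folklore] -/
theorem algebraMap_origin_injective [IsDomain T] (F : T) (hF0 : F ≠ 0)
    (hX : algebraMap (OriginLocalization k₀ 1) T
      (algebraMap (MvPolynomial (Fin 1) k₀) (OriginLocalization k₀ 1) (X 0)) = F) :
    Function.Injective (algebraMap (OriginLocalization k₀ 1) T) := by
  haveI := isDomain_of_isRegularLocalRing (OriginLocalization k₀ 1)
  haveI : IsDiscreteValuationRing (OriginLocalization k₀ 1) := isDiscreteValuationRing_origin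
  rw [RingHom.injective_iff_ker_eq_bot]
  by_contra hker
  have hmax : (RingHom.ker (algebraMap (OriginLocalization k₀ 1) T)).IsMaximal :=
    Ideal.IsPrime.isMaximal (RingHom.ker_isPrime _) hker
  have hmem : algebraMap (MvPolynomial (Fin 1) k₀) (OriginLocalization k₀ 1) (X 0) ∈
      RingHom.ker (algebraMap (OriginLocalization k₀ 1) T) := by
    rw [IsLocalRing.eq_maximalIdeal hmax, ← Localization.AtPrime.map_eq_maximalIdeal]
    exact Ideal.mem_map_of_mem _ ((mem_originIdeal_iff k₀ 1).mpr (constantCoeff_X k₀ 0))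
  rw [RingHom.mem_ker, hX] at hmem
  exact hF0 hmem

/-- … hence a domain `T` is FLAT over `k₀[X]_{(X)}` along such a map (torsion-free over a Bézout domain). [folklore] -/
theorem flat_origin [IsDomain T] (F : T) (hF0 : F ≠ 0)
    (hX : algebraMap (OriginLocalization k₀ 1) T
      (algebraMap (MvPolynomial (Fin 1) k₀) (OriginLocalization k₀ 1) (X 0)) = F) :
    Module.Flat (OriginLocalization k₀ 1) T := by
  haveI := isDomain_of_isRegularLocalRing (OriginLocalization k₀ 1)
  haveI : IsDiscreteValuationRing (OriginLocalization k₀ 1) := isDiscreteValuationRing_origin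
  rw [Module.Flat.flat_iff_torsion_eq_bot_of_isBezout, ← Submodule.isTorsionFree_iff_torsion_eq_bot]
  exact Module.isTorsionFree_iff_algebraMap_injective.mpr (algebraMap_origin_injective F hF0 hX)

end Injective

section Reference

variable {k₀ : Type} [Field k₀] {T : Type} [CommRing T] [Algebra k₀ T]
  [Algebra (OriginLocalization k₀ 1) T] [IsScalarTower k₀ (OriginLocalization k₀ 1) T]

/-- A `k₀`-compatible map `k₀[X]_{(X)} → T` is evaluation at the image `F` of `X` on polynomials. [folklore] -/
theorem algebraMap_origin_apply_eq_aeval (F : T)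
    (hX : algebraMap (OriginLocalization k₀ 1) T
      (algebraMap (MvPolynomial (Fin 1) k₀) (OriginLocalization k₀ 1) (X 0)) = F)
    (f : MvPolynomial (Fin 1) k₀) :
    algebraMap (OriginLocalization k₀ 1) T (algebraMap (MvPolynomial (Fin 1) k₀) (OriginLocalization k₀ 1) f) =
      MvPolynomial.aeval (fun _ : Fin 1 => F) f := by
  have key : ((IsScalarTower.toAlgHom k₀ (OriginLocalization k₀ 1) T).comp
      (IsScalarTower.toAlgHom k₀ (MvPolynomial (Fin 1) k₀) (OriginLocalization k₀ 1))) =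
      MvPolynomial.aeval (fun _ : Fin 1 => F) := by
    apply MvPolynomial.algHom_ext
    intro i
    rw [AlgHom.comp_apply, IsScalarTower.toAlgHom_apply, IsScalarTower.toAlgHom_apply, MvPolynomial.aeval_X,
      Fin.fin_one_eq_zero i, hX]
  have := congrArg (fun φ : MvPolynomial (Fin 1) k₀ →ₐ[k₀] T => φ f) key
  simpa only [AlgHom.comp_apply, IsScalarTower.toAlgHom_apply] using this

/-- Along a `k₀`-compatible map `k₀[X]_{(X)} → T` with `X ↦ F`, the maximal ideal `(X)` extends to `(F)`. [folklore] -/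
theorem map_maximalIdeal_origin_eq_span (F : T)
    (hX : algebraMap (OriginLocalization k₀ 1) T
      (algebraMap (MvPolynomial (Fin 1) k₀) (OriginLocalization k₀ 1) (X 0)) = F) :
    (maximalIdeal (OriginLocalization k₀ 1)).map (algebraMap (OriginLocalization k₀ 1) T) = Ideal.span {F} := by
  have hcomp : (algebraMap (OriginLocalization k₀ 1) T).comp
      (algebraMap (MvPolynomial (Fin 1) k₀) (OriginLocalization k₀ 1)) =
      (MvPolynomial.aeval (fun _ : Fin 1 => F)).toRingHom :=
    RingHom.ext fun f => algebraMap_origin_apply_eq_aeval F hX f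
  rw [← Localization.AtPrime.map_eq_maximalIdeal, Ideal.map_map, hcomp]
  calc Ideal.map (MvPolynomial.aeval (fun _ : Fin 1 => F)).toRingHom (originIdeal k₀ 1)
      = Ideal.map (MvPolynomial.aeval (fun _ : Fin 1 => F)).toRingHom
          (Ideal.span (Set.range (X : Fin 1 → MvPolynomial (Fin 1) k₀))) :=
        congrArg _ (originIdeal_eq_span k₀ 1)
    _ = Ideal.span {F} := by
        rw [Ideal.map_span, ← Set.range_comp]
        congr 1
        ext x
        simp only [Set.mem_range, Function.comp_apply, Set.mem_singleton_iff, AlgHom.toRingHom_eq_coe,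
          RingHom.coe_coe, MvPolynomial.aeval_X]
        constructor
        · rintro ⟨i, rfl⟩; rfl
        · rintro rfl; exact ⟨0, rfl⟩

/-- Along a `k₀`-compatible map `k₀[X]_{(X)} → T` with `X ↦ F ∈ 𝔪_T` (`T` local) the map is a local homomorphism.
[folklore] -/
theorem isLocalHom_algebraMap_origin [IsLocalRing T] (F : T) (hF : F ∈ maximalIdeal T)
    (hX : algebraMap (OriginLocalization k₀ 1) T
      (algebraMap (MvPolynomial (Fin 1) k₀) (OriginLocalization k₀ 1) (X 0)) = F) :
    IsLocalHom (algebraMap (OriginLocalization k₀ 1) T) := by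
  apply ((IsLocalRing.local_hom_TFAE (algebraMap (OriginLocalization k₀ 1) T)).out 0 2).mpr
  rw [map_maximalIdeal_origin_eq_span F hX, Ideal.span_singleton_le_iff_mem]
  exact hF

/-- Along a `k₀`-compatible map `k₀[X]_{(X)} → T` with `X ↦ F`, `F` a REGULAR PARAMETER of the regular local ring `T`
(`F ∈ 𝔪_T ∖ 𝔪_T²`), the fibre ring `κ ⊗ T ≅ T/(F)` is a regular local ring. [folklore] -/
theorem isRegularLocalRing_fiber_origin [IsRegularLocalRing T] (F : T) (hF : F ∈ maximalIdeal T)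
    (hF2 : F ∉ (maximalIdeal T) ^ 2)
    (hX : algebraMap (OriginLocalization k₀ 1) T
      (algebraMap (MvPolynomial (Fin 1) k₀) (OriginLocalization k₀ 1) (X 0)) = F) :
    IsRegularLocalRing (ResidueField (OriginLocalization k₀ 1) ⊗[OriginLocalization k₀ 1] T) := by
  classical
  -- `T/(F)` is regular
  have hsub : ((({F} : Finset T) : Set T)) ⊆ maximalIdeal T := by
    intro x hx
    rw [Finset.coe_singleton, Set.mem_singleton_iff] at hx
    rw [hx]; exact hF
  haveI : Subsingleton (({F} : Finset T) : Type) :=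
    ⟨fun a b => Subtype.ext ((Finset.mem_singleton.mp a.2).trans (Finset.mem_singleton.mp b.2).symm)⟩
  have hli : LinearIndependent (ResidueField T)
      (fun x : ({F} : Finset T) => (maximalIdeal T).toCotangent ⟨x, hsub x.2⟩) := by
    refine (linearIndependent_subsingleton_index_iff _).mpr fun x => ?_
    rw [Ne, Ideal.toCotangent_eq_zero]
    have hx' : (x : T) = F := Finset.mem_singleton.mp x.2
    simpa [hx'] using hF2
  have hq : IsRegularLocalRing (T ⧸ Ideal.span ((({F} : Finset T) : Set T))) :=
    isRegularLocalRing_quotient_span ({F} : Finset T) hsub hli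
  have hspan : Ideal.span ((({F} : Finset T) : Set T)) =
      (maximalIdeal (OriginLocalization k₀ 1)).map (algebraMap (OriginLocalization k₀ 1) T) := by
    rw [Finset.coe_singleton, map_maximalIdeal_origin_eq_span F hX]
  have e₁ : (T ⧸ (maximalIdeal (OriginLocalization k₀ 1)).map (algebraMap (OriginLocalization k₀ 1) T)) ≃+*
      ResidueField (OriginLocalization k₀ 1) ⊗[OriginLocalization k₀ 1] T :=
    (Algebra.TensorProduct.quotIdealMapEquivTensorQuot T (maximalIdeal (OriginLocalization k₀ 1))).toRingEquiv.trans
      (Algebra.TensorProduct.comm (OriginLocalization k₀ 1) T (ResidueField (OriginLocalization k₀ 1))).toRingEquiv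
  haveI := hq
  exact IsRegularLocalRing.of_ringEquiv ((Ideal.quotEquivOfEq hspan).trans e₁)

/-- **The structure map `k₀[X]_{(X)} → T`, `X ↦ F` a regular parameter, is formally smooth** (`k₀` perfect, `T` an
essentially-of-finite-type regular local `k₀`-algebra): it is local, essentially of finite type, flat (torsion-free
over a discrete valuation ring) with regular closed fibre `T/(F)` over the perfect residue field `k₀`, so the tree's
`formallySmooth_of_flat_of_isRegularLocalRing_fiber` (Stacks 00TF, regular-fibre form) applies.
[cite: StacksProject, Tag 00TF] -/
theorem formallySmooth_origin [PerfectField k₀] [Algebra.EssFiniteType k₀ T] [IsRegularLocalRing T] (F : T)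
    (hF : F ∈ maximalIdeal T) (hF2 : F ∉ (maximalIdeal T) ^ 2)
    (hX : algebraMap (OriginLocalization k₀ 1) T
      (algebraMap (MvPolynomial (Fin 1) k₀) (OriginLocalization k₀ 1) (X 0)) = F) :
    Algebra.FormallySmooth (OriginLocalization k₀ 1) T := by
  have hF0 : F ≠ 0 := by
    rintro rfl
    exact hF2 (Ideal.zero_mem _)
  haveI := isDomain_of_isRegularLocalRing T
  haveI := isLocalHom_algebraMap_origin F hF hX
  haveI : Algebra.EssFiniteType (OriginLocalization k₀ 1) T := Algebra.EssFiniteType.of_comp k₀ _ T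
  haveI : Module.Flat (OriginLocalization k₀ 1) T := flat_origin F hF0 hX
  haveI : PerfectField (ResidueField (OriginLocalization k₀ 1)) := perfectField_residueField_origin
  exact formallySmooth_of_flat_of_isRegularLocalRing_fiber (OriginLocalization k₀ 1) T
    (isRegularLocalRing_fiber_origin F hF hF2 hX)

end Reference

/-! ## ι-rigidity at regular parameters under (c11) -/

section Rigidity

variable {ι : (R : Type) → [CommRing R] → R → Ordinal.{0}} {J : (R : Type) → [CommRing R] → R → ℕ → Ideal R}

/-- **ι-RIGIDITY AT REGULAR PARAMETERS** (consequence of clause (c11) `IotaJEssSmoothCompatible` of the H2a‴/H2a⁗ modules).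
Let `k₀` be perfect, `T` a regular local `k₀`-algebra essentially of finite type (any Krull dimension; the local ring of
a smooth `k₀`-scheme at ANY point) and `F ∈ 𝔪_T ∖ 𝔪_T²` a regular parameter.  Then
`ι T F = ι (k₀[X]_{(X)}) X`: the value of `ι` at a regular parameter is ONE constant `c₀(k₀)`.  Proof: evaluation
`X ↦ F` is a local, essentially-of-finite-type, formally smooth homomorphism of regular local rings
(`formallySmooth_origin`), along which (c11) preserves `ι`. [OURS · L1 W4.3, kernel] -/
theorem iota_regularParameter_eq_origin (hJs : IotaJEssSmoothCompatible ι J)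
    (k₀ : Type) [Field k₀] [PerfectField k₀]
    (T : Type) [CommRing T] [Algebra k₀ T] [Algebra.EssFiniteType k₀ T] [IsRegularLocalRing T]
    (F : T) (hF : F ∈ maximalIdeal T) (hF2 : F ∉ (maximalIdeal T) ^ 2) :
    ι T F = ι (OriginLocalization k₀ 1)
      (algebraMap (MvPolynomial (Fin 1) k₀) (OriginLocalization k₀ 1) (X 0)) := by
  -- the evaluation map `X ↦ F`
  have hunit : ∀ s : (originIdeal k₀ 1).primeCompl,
      IsUnit ((MvPolynomial.aeval (fun _ : Fin 1 => F)).toRingHom (s : MvPolynomial (Fin 1) k₀)) :=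
    fun s => isUnit_aeval_of_constantCoeff_ne_zero (fun _ : Fin 1 => F) (fun _ => hF)
      (fun h => s.2 ((mem_originIdeal_iff k₀ 1).mpr h))
  letI : Algebra (OriginLocalization k₀ 1) T :=
    (IsLocalization.lift (M := (originIdeal k₀ 1).primeCompl) (S := OriginLocalization k₀ 1) hunit).toAlgebra
  have hφ : ∀ f : MvPolynomial (Fin 1) k₀, algebraMap (OriginLocalization k₀ 1) T
      (algebraMap (MvPolynomial (Fin 1) k₀) (OriginLocalization k₀ 1) f) = MvPolynomial.aeval (fun _ : Fin 1 => F) f :=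
    fun f => IsLocalization.lift_eq hunit f
  haveI : IsScalarTower k₀ (OriginLocalization k₀ 1) T := IsScalarTower.of_algebraMap_eq fun c => by
    rw [IsScalarTower.algebraMap_apply k₀ (MvPolynomial (Fin 1) k₀) (OriginLocalization k₀ 1), hφ,
      MvPolynomial.algebraMap_eq, MvPolynomial.aeval_C]
  have hX : algebraMap (OriginLocalization k₀ 1) T
      (algebraMap (MvPolynomial (Fin 1) k₀) (OriginLocalization k₀ 1) (X 0)) = F := by
    rw [hφ, MvPolynomial.aeval_X]
  haveI := isLocalHom_algebraMap_origin F hF hX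
  haveI : Algebra.EssFiniteType (OriginLocalization k₀ 1) T := Algebra.EssFiniteType.of_comp k₀ _ T
  haveI : Algebra.FormallySmooth (OriginLocalization k₀ 1) T := formallySmooth_origin F hF hF2 hX
  have h := (hJs (OriginLocalization k₀ 1) T
    (algebraMap (MvPolynomial (Fin 1) k₀) (OriginLocalization k₀ 1) (X 0))).1
  rw [hX] at h
  exact h

/-- **Any two regular parameters, in any two e.f.t. regular local algebras over the same perfect field, carry the same
`ι`-value** under (c11). [OURS · L1 W4.3, kernel] -/
theorem iota_regularParameter_eq (hJs : IotaJEssSmoothCompatible ι J)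
    (k₀ : Type) [Field k₀] [PerfectField k₀]
    (T : Type) [CommRing T] [Algebra k₀ T] [Algebra.EssFiniteType k₀ T] [IsRegularLocalRing T]
    (T' : Type) [CommRing T'] [Algebra k₀ T'] [Algebra.EssFiniteType k₀ T'] [IsRegularLocalRing T']
    (F : T) (hF : F ∈ maximalIdeal T) (hF2 : F ∉ (maximalIdeal T) ^ 2)
    (F' : T') (hF' : F' ∈ maximalIdeal T') (hF'2 : F' ∉ (maximalIdeal T') ^ 2) :
    ι T F = ι T' F' := by
  rw [iota_regularParameter_eq_origin hJs k₀ T F hF hF2, iota_regularParameter_eq_origin hJs k₀ T' F' hF' hF'2]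

/-! ## Regular versus singular: strictness from (strat) + (adm) + (c7) -/

/-- **At a generization where `f` becomes a regular parameter, `ι` is STRICTLY smaller than at the singular
position** — from the canonical game clause (c9′) ((strat): equality of `ι` would force the centre prime `P ≤ 𝔭`, and
then (adm) puts `f` into `𝔪_{S_𝔭}²`) and (c7) (`≤`).  No rigidity is needed for this half. [OURS · L1 W4.3, kernel] -/
theorem iota_localization_lt_of_not_mem_sq {p : ℕ} (hc7 : IotaGenerizationMonotone ι)
    (hgame : CanonicalGameClause p ι J)
    (k₀ : Type) [Field k₀] [CharP k₀ p] [PerfectField k₀]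
    (S : Type) [CommRing S] [Algebra k₀ S] [Algebra.EssFiniteType k₀ S] [IsRegularLocalRing S]
    (f : S) (hf0 : f ≠ 0) (hf2 : f ∈ (maximalIdeal S) ^ 2)
    (𝔭 : Ideal S) [𝔭.IsPrime] (hf𝔭 : f ∈ 𝔭)
    (hreg : algebraMap S (Localization.AtPrime 𝔭) f ∉ (maximalIdeal (Localization.AtPrime 𝔭)) ^ 2) :
    ι (Localization.AtPrime 𝔭) (algebraMap S (Localization.AtPrime 𝔭) f) < ι S f := by
  obtain ⟨P, hP, -, -, hstrat, -, -, -, -, -, -, -, -, -, hadm, -⟩ := hgame k₀ S f hf0 hf2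
  refine lt_of_le_of_ne (hc7 S 𝔭 f) fun heq => ?_
  haveI := hP
  exact hreg (hadm 𝔭 ((hstrat 𝔭 hf𝔭).mp heq))

/-- **ι SEPARATES REGULAR FROM SINGULAR POINTS** (under (c11), (c7) and the canonical game clause (c9′)): the common
value of `ι` at regular parameters (`iota_regularParameter_eq`) is STRICTLY below `ι S f` for every singular e.f.t.
position `(S, f)` having a generization `𝔭 ∋ f` at which `f` is a regular parameter (e.g. the generic point of an
integral hypersurface through the point).  This is the fact the door assembly's termination step [S6] uses at the
REGULAR points of the strict transform on the exceptional divisor, where the game clause's drop conclusion does not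
fire. [OURS · L1 W4.3, kernel] -/
theorem iota_regularParameter_lt_of_singular {p : ℕ} (hJs : IotaJEssSmoothCompatible ι J)
    (hc7 : IotaGenerizationMonotone ι) (hgame : CanonicalGameClause p ι J)
    (k₀ : Type) [Field k₀] [CharP k₀ p] [PerfectField k₀]
    (T : Type) [CommRing T] [Algebra k₀ T] [Algebra.EssFiniteType k₀ T] [IsRegularLocalRing T]
    (G : T) (hG : G ∈ maximalIdeal T) (hG2 : G ∉ (maximalIdeal T) ^ 2)
    (S : Type) [CommRing S] [Algebra k₀ S] [Algebra.EssFiniteType k₀ S] [IsRegularLocalRing S]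
    (f : S) (hf0 : f ≠ 0) (hf2 : f ∈ (maximalIdeal S) ^ 2)
    (𝔭 : Ideal S) [𝔭.IsPrime] (hf𝔭 : f ∈ 𝔭)
    (hreg : algebraMap S (Localization.AtPrime 𝔭) f ∉ (maximalIdeal (Localization.AtPrime 𝔭)) ^ 2) :
    ι T G < ι S f := by
  haveI : IsRegularLocalRing (Localization.AtPrime 𝔭) := isRegularLocalRing_localization_atPrime S 𝔭
  have hmem : algebraMap S (Localization.AtPrime 𝔭) f ∈ maximalIdeal (Localization.AtPrime 𝔭) :=
    (IsLocalization.AtPrime.to_map_mem_maximal_iff (Localization.AtPrime 𝔭) 𝔭 f).mpr hf𝔭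
  rw [iota_regularParameter_eq hJs k₀ T (Localization.AtPrime 𝔭) G hG hG2 _ hmem hreg]
  exact iota_localization_lt_of_not_mem_sq hc7 hgame k₀ S f hf0 hf2 𝔭 hf𝔭 hreg

end Rigidity

end Summit.ResolutionOfSingularities.ResolutionOfSingularities.Cruxes.HypersurfaceCentreConstruction.LocalEngine

end
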